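import Literature.Probability.LatticeModels.CollarLegModelCellRegion
import Literature.Probability.Percolation.CellSides

/-!
# Stub `stub_dictionaryPositivity` of line `rainbow-monomials-in-excursion-kernels` — Part 24:
# the cell region of a collar leg model in the coordinates of `CellBoundary` (dictionary) and its
# edge-connectedness (crux `BoundaryDefectGaussianR`, stmt-CriticalPhenomena-14132; insertion
# dictionary D2, layer 3c: the rim of the cell region)

First of three files (Parts 24–26) on the RIM of the cell region of a collar leg model
`M : Literature.Probability.LatticeModels.CollarLegModel` (registered sub-goal `s15_cellRegion_rim`,
Part 26). The cell region `M.cellRegion : Finset (ℤ × ℤ)` (`CollarLegModelCellRegion.lean`: the unit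
squares `vcell x = (x₁ + x₂ - 1, x₂ - x₁)` of the vertex-cells `x ∈ M.vertexCells = V ∪ ghosts` and
`fcell f = (f₁ + f₂, f₂ - f₁)` of the face-cells `f ∈ M.faceCells` = faces with a corner in `V`, in the
medial coordinates of `MedialTrail`) is transported to the cell-complex files
`Literature/Probability/Percolation/CellBoundary.lean`, `CellSides.lean` as
`U = M.cellRegion.image (fun F ↦ ![F.1, F.2]) : Finset (Fin 2 → ℤ)` (written inline everywhere).

This file is the dictionary between the two coordinate systems and the first of the three
hypotheses of the single-boundary-cycle theorem `CellComplex.exists_eq_bdOrbit_of_isBd`: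

* `crr_mem_U_vertex`, `crr_mem_U_face` — `![p + q - 1, q - p] ∈ U ↔ (p, q) ∈ M.vertexCells`,
  `![p + q, q - p] ∈ U ↔ (p, q) ∈ M.faceCells`; every cell is of one of the two forms
  (`crr_cell_cases`, parity of the coordinate sum);
* `crr_medial_cases`, `crr_faces_h`, `crr_faces_v` — every medial point (corner of cells) is the
  midpoint of a horizontal or of a vertical lattice edge `(b, b + eᵢ)`, and the four cells `faceAt w k`
  around it are the two vertex squares of the endpoints and the two face squares of the side faces;
* `crr_ghost_layer` — ghosts lie in the FIRST LAYER around `V` (outside `V`, king-adjacent to `V`):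
  the only property of the collar used in Parts 24–26;
* `crr_cellAdj_of_corner`, `crr_cellAdj_vertex_cases`, `crr_cellAdj_face_cases` — edge-adjacency
  `CellComplex.CellAdj` in coordinates: the vertex square of `x` and the face square of `f` are
  adjacent iff `x` is a corner of `f`;
* `crr_edgeConn` / registered `s15_cellRegion_edgeConn` — **if `V` is lattice-connected then `U` is
  edge-connected** (every cell is joined to the vertex square of a vertex of `V` through a face
  square; lattice steps of `V` are two cell steps).

Everything is proved; no named fact is introduced.
-/

namespace Summit.CriticalPhenomena.CardyFormulaZ2.Cruxes.BoundaryDefectGaussianR.RainbowMonomialsInExcursionKernels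

open Literature.Probability.LatticeModels Literature.Probability.LatticeModels.CollarLegModel
open Literature.Probability.Percolation Literature.Probability.Percolation.CellComplex

/-! ### Coordinates: cells and medial points of `Fin 2 → ℤ` versus vertices, faces and edges of `ℤ × ℤ` -/

/-- Every point of `Fin 2 → ℤ` is the vector of its two coordinates. [folklore] -/
theorem crr_site_eq (c : Fin 2 → ℤ) : c = ![c 0, c 1] := by
  ext i; fin_cases i <;> rfl

/-- Membership in the transported cell region is membership of the coordinate pair. [folklore] -/
theorem crr_mem_image_iff (S : Finset (ℤ × ℤ)) (A B : ℤ) :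
    (![A, B] : Fin 2 → ℤ) ∈ S.image (fun F : ℤ × ℤ ↦ (![F.1, F.2] : Fin 2 → ℤ)) ↔ (A, B) ∈ S := by
  rw [Finset.mem_image]
  constructor
  · rintro ⟨⟨A', B'⟩, h, hAB⟩
    have h0 := congrFun hAB 0
    have h1 := congrFun hAB 1
    simp only [Matrix.cons_val_zero, Matrix.cons_val_one, Matrix.cons_val_fin_one] at h0 h1
    subst h0; subst h1; exact h
  · intro h
    exact ⟨(A, B), h, rfl⟩

/-- The cell region in coordinates: vertex squares `(x₁ + x₂ - 1, x₂ - x₁)` of the vertex-cells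
and face squares `(f₁ + f₂, f₂ - f₁)` of the face-cells. [folklore] -/
theorem crr_mem_cellRegion_iff (M : CollarLegModel) (A B : ℤ) :
    (A, B) ∈ M.cellRegion ↔ (∃ x ∈ M.vertexCells, x.1 + x.2 - 1 = A ∧ x.2 - x.1 = B) ∨
      (∃ f ∈ M.faceCells, f.1 + f.2 = A ∧ f.2 - f.1 = B) := by
  simp only [cellRegion, Finset.mem_union, Finset.mem_image, vcell, fcell, toSite,
    Matrix.cons_val_zero, Matrix.cons_val_one, Matrix.cons_val_fin_one, Prod.mk.injEq]

/-- **A vertex square lies in the transported cell region iff its vertex is a vertex-cell.** [folklore] -/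
theorem crr_mem_U_vertex (M : CollarLegModel) (p q : ℤ) :
    (![p + q - 1, q - p] : Fin 2 → ℤ) ∈ M.cellRegion.image (fun F : ℤ × ℤ ↦ (![F.1, F.2] : Fin 2 → ℤ)) ↔
      (p, q) ∈ M.vertexCells := by
  rw [crr_mem_image_iff, crr_mem_cellRegion_iff]
  constructor
  · rintro (⟨y, hy, h1, h2⟩ | ⟨f, _, h1, h2⟩)
    · have : y = (p, q) := Prod.ext (by omega) (by omega)
      subst this; exact hy
    · exfalso; omega
  · intro hx
    exact Or.inl ⟨(p, q), hx, rfl, rfl⟩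

/-- **A face square lies in the transported cell region iff its face is a face-cell.** [folklore] -/
theorem crr_mem_U_face (M : CollarLegModel) (p q : ℤ) :
    (![p + q, q - p] : Fin 2 → ℤ) ∈ M.cellRegion.image (fun F : ℤ × ℤ ↦ (![F.1, F.2] : Fin 2 → ℤ)) ↔
      (p, q) ∈ M.faceCells := by
  rw [crr_mem_image_iff, crr_mem_cellRegion_iff]
  constructor
  · rintro (⟨y, _, h1, h2⟩ | ⟨f, hf, h1, h2⟩)
    · exfalso; omega
    · have : f = (p, q) := Prod.ext (by omega) (by omega)
      subst this; exact hf
  · intro hx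
    exact Or.inr ⟨(p, q), hx, rfl, rfl⟩

/-- Every cell is a vertex square (odd coordinate sum) or a face square (even sum). [folklore] -/
theorem crr_cell_cases (c : Fin 2 → ℤ) :
    (∃ x : ℤ × ℤ, c = ![x.1 + x.2 - 1, x.2 - x.1]) ∨ (∃ f : ℤ × ℤ, c = ![f.1 + f.2, f.2 - f.1]) := by
  rcases Int.emod_two_eq_zero_or_one (c 0 + c 1) with h | h
  · refine Or.inr ⟨((c 0 - c 1) / 2, (c 0 + c 1) / 2), ?_⟩
    ext i; fin_cases i <;> simp <;> omega
  · refine Or.inl ⟨((c 0 + 1 - c 1) / 2, (c 0 + 1 + c 1) / 2), ?_⟩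
    ext i; fin_cases i <;> simp <;> omega

/-- Every medial point (corner of cells) is the midpoint of a horizontal lattice edge
`(b, b + e₁)` — coordinates `(b₁ + b₂, b₂ - b₁)` — or of a vertical one `(b, b + e₂)` — coordinates
`(b₁ + b₂, b₂ - b₁ + 1)`. [folklore] -/
theorem crr_medial_cases (w : Fin 2 → ℤ) :
    (∃ b : ℤ × ℤ, w = ![b.1 + b.2, b.2 - b.1]) ∨ (∃ b : ℤ × ℤ, w = ![b.1 + b.2, b.2 - b.1 + 1]) := by
  rcases Int.emod_two_eq_zero_or_one (w 0 + w 1) with h | h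
  · refine Or.inl ⟨((w 0 - w 1) / 2, (w 0 + w 1) / 2), ?_⟩
    ext i; fin_cases i <;> simp <;> omega
  · refine Or.inr ⟨((w 0 - w 1 + 1) / 2, (w 0 + w 1 - 1) / 2), ?_⟩
    ext i; fin_cases i <;> simp <;> omega

/-- The four cells at the midpoint of the horizontal edge `(b, b + e₁)`: the face square of the
face `b` above it, the vertex square of `b`, the face square of the face `b - e₂` below it, the
vertex square of `b + e₁`. [folklore] -/
theorem crr_faceAt_h (b : ℤ × ℤ) :
    faceAt ![b.1 + b.2, b.2 - b.1] 0 = ![b.1 + b.2, b.2 - b.1] ∧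
    faceAt ![b.1 + b.2, b.2 - b.1] 1 = ![b.1 + b.2 - 1, b.2 - b.1] ∧
    faceAt ![b.1 + b.2, b.2 - b.1] 2 = ![b.1 + (b.2 - 1), (b.2 - 1) - b.1] ∧
    faceAt ![b.1 + b.2, b.2 - b.1] 3 = ![(b.1 + 1) + b.2 - 1, b.2 - (b.1 + 1)] := by
  refine ⟨?_, ?_, ?_, ?_⟩ <;> ext i <;> fin_cases i <;> simp [faceAt, cornerOff] <;> ring

/-- The four cells at the midpoint of the vertical edge `(b, b + e₂)`: the vertex square of
`b + e₂`, the face square of the face `b - e₁` on its left, the vertex square of `b`, the face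
square of the face `b` on its right. [folklore] -/
theorem crr_faceAt_v (b : ℤ × ℤ) :
    faceAt ![b.1 + b.2, b.2 - b.1 + 1] 0 = ![b.1 + (b.2 + 1) - 1, (b.2 + 1) - b.1] ∧
    faceAt ![b.1 + b.2, b.2 - b.1 + 1] 1 = ![(b.1 - 1) + b.2, b.2 - (b.1 - 1)] ∧
    faceAt ![b.1 + b.2, b.2 - b.1 + 1] 2 = ![b.1 + b.2 - 1, b.2 - b.1] ∧
    faceAt ![b.1 + b.2, b.2 - b.1 + 1] 3 = ![b.1 + b.2, b.2 - b.1] := by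
  refine ⟨?_, ?_, ?_, ?_⟩ <;> ext i <;> fin_cases i <;> simp [faceAt, cornerOff] <;> ring

/-- Membership of the four cells at the midpoint of a horizontal edge. [folklore] -/
theorem crr_faces_h (M : CollarLegModel) (b : ℤ × ℤ) :
    (faceAt ![b.1 + b.2, b.2 - b.1] 0 ∈ M.cellRegion.image (fun F : ℤ × ℤ ↦ (![F.1, F.2] : Fin 2 → ℤ)) ↔
        (b.1, b.2) ∈ M.faceCells) ∧
    (faceAt ![b.1 + b.2, b.2 - b.1] 1 ∈ M.cellRegion.image (fun F : ℤ × ℤ ↦ (![F.1, F.2] : Fin 2 → ℤ)) ↔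
        (b.1, b.2) ∈ M.vertexCells) ∧
    (faceAt ![b.1 + b.2, b.2 - b.1] 2 ∈ M.cellRegion.image (fun F : ℤ × ℤ ↦ (![F.1, F.2] : Fin 2 → ℤ)) ↔
        (b.1, b.2 - 1) ∈ M.faceCells) ∧
    (faceAt ![b.1 + b.2, b.2 - b.1] 3 ∈ M.cellRegion.image (fun F : ℤ × ℤ ↦ (![F.1, F.2] : Fin 2 → ℤ)) ↔
        (b.1 + 1, b.2) ∈ M.vertexCells) := by
  obtain ⟨h0, h1, h2, h3⟩ := crr_faceAt_h b
  rw [h0, h1, h2, h3, crr_mem_U_face, crr_mem_U_vertex, crr_mem_U_face, crr_mem_U_vertex]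
  exact ⟨Iff.rfl, Iff.rfl, Iff.rfl, Iff.rfl⟩

/-- Membership of the four cells at the midpoint of a vertical edge. [folklore] -/
theorem crr_faces_v (M : CollarLegModel) (b : ℤ × ℤ) :
    (faceAt ![b.1 + b.2, b.2 - b.1 + 1] 0 ∈ M.cellRegion.image (fun F : ℤ × ℤ ↦ (![F.1, F.2] : Fin 2 → ℤ)) ↔
        (b.1, b.2 + 1) ∈ M.vertexCells) ∧
    (faceAt ![b.1 + b.2, b.2 - b.1 + 1] 1 ∈ M.cellRegion.image (fun F : ℤ × ℤ ↦ (![F.1, F.2] : Fin 2 → ℤ)) ↔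
        (b.1 - 1, b.2) ∈ M.faceCells) ∧
    (faceAt ![b.1 + b.2, b.2 - b.1 + 1] 2 ∈ M.cellRegion.image (fun F : ℤ × ℤ ↦ (![F.1, F.2] : Fin 2 → ℤ)) ↔
        (b.1, b.2) ∈ M.vertexCells) ∧
    (faceAt ![b.1 + b.2, b.2 - b.1 + 1] 3 ∈ M.cellRegion.image (fun F : ℤ × ℤ ↦ (![F.1, F.2] : Fin 2 → ℤ)) ↔
        (b.1, b.2) ∈ M.faceCells) := by
  obtain ⟨h0, h1, h2, h3⟩ := crr_faceAt_v b
  rw [h0, h1, h2, h3, crr_mem_U_face, crr_mem_U_vertex, crr_mem_U_face, crr_mem_U_vertex]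
  exact ⟨Iff.rfl, Iff.rfl, Iff.rfl, Iff.rfl⟩

/-! ### Face-cells, vertex-cells and ghosts in coordinates -/

/-- A face is a face-cell iff one of its four corners lies in `V`. [folklore] -/
theorem crr_mem_faceCells_iff (M : CollarLegModel) (f : ℤ × ℤ) :
    f ∈ M.faceCells ↔ ∃ u ∈ M.V, f.1 ≤ u.1 ∧ u.1 ≤ f.1 + 1 ∧ f.2 ≤ u.2 ∧ u.2 ≤ f.2 + 1 := by
  simp only [faceCells, SixVertex.faces, Finset.mem_biUnion, SixVertex.vertexFaces, Finset.mem_insert,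
    Finset.mem_singleton, Prod.ext_iff]
  constructor
  · rintro ⟨u, hu, h⟩
    exact ⟨u, hu, by omega⟩
  · rintro ⟨u, hu, h⟩
    exact ⟨u, hu, by omega⟩

/-- Vertex-cells are the vertices of `V` and the ghosts. [folklore] -/
theorem crr_mem_vertexCells_iff (M : CollarLegModel) (x : ℤ × ℤ) :
    x ∈ M.vertexCells ↔ x ∈ M.V ∨ x ∈ M.ghosts := Finset.mem_union

/-- **Ghosts lie in the first layer around `V`**: a ghost is not in `V` and is a king-neighbour of a
vertex of `V` (it is a lattice neighbour of an arc vertex, or a corner of a pocket, which is a face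
with a corner in `V`). [folklore] -/
theorem crr_ghost_layer (M : CollarLegModel) {x : ℤ × ℤ} (hx : x ∈ M.ghosts) :
    x ∉ M.V ∧ ∃ v ∈ M.V, max |v.1 - x.1| |v.2 - x.2| ≤ 1 := by
  simp only [ghosts, Finset.mem_sdiff, Finset.mem_union, Finset.mem_biUnion] at hx
  obtain ⟨h | h, hxV⟩ := hx
  · obtain ⟨a, ha, hxa⟩ := h
    have haV : a ∈ M.V := (Finset.mem_inter.1 ha).2
    refine ⟨hxV, a, haV, ?_⟩
    simp only [neighbours, Finset.mem_insert, Finset.mem_singleton, Prod.ext_iff] at hxa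
    simp only [max_le_iff, abs_le]
    omega
  · obtain ⟨p, hp, hxp⟩ := h
    have hpF : p ∈ SixVertex.faces M.V := (Finset.mem_filter.1 (Finset.mem_inter.1 hp).2).1
    obtain ⟨u, hu, hbox⟩ := (crr_mem_faceCells_iff M p).1 hpF
    refine ⟨hxV, u, hu, ?_⟩
    simp only [SixVertex.faceCorners, Finset.mem_insert, Finset.mem_singleton, Prod.ext_iff] at hxp
    simp only [max_le_iff, abs_le]
    omega

/-- A lattice point with no vertex of `V` among its king-neighbours is not a vertex-cell. [folklore] -/
theorem crr_not_mem_vertexCells_of_free (M : CollarLegModel) {x : ℤ × ℤ}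
    (hx : ¬∃ v ∈ M.V, max |v.1 - x.1| |v.2 - x.2| ≤ 1) : x ∉ M.vertexCells := by
  rw [crr_mem_vertexCells_iff]
  rintro (h | h)
  · exact hx ⟨x, h, by simp⟩
  · exact hx (crr_ghost_layer M h).2

/-- A face none of whose corners is in `V` is not a face-cell. [folklore] -/
theorem crr_not_mem_faceCells_of_free (M : CollarLegModel) {f : ℤ × ℤ}
    (hf : ∀ u ∈ M.V, ¬(f.1 ≤ u.1 ∧ u.1 ≤ f.1 + 1 ∧ f.2 ≤ u.2 ∧ u.2 ≤ f.2 + 1)) : f ∉ M.faceCells := by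
  rw [crr_mem_faceCells_iff]
  rintro ⟨u, hu, h⟩
  exact hf u hu h

/-! ### Edge-adjacency of cells in coordinates -/

/-- A cell is edge-adjacent to its four translates by unit vectors. [folklore] -/
theorem crr_cellAdj_add_unit (c : Fin 2 → ℤ) (j : Fin 4) : CellAdj c (c + cornerUnit j) := by
  refine ⟨c + cornerOff (j + 1), j + 1, ?_, ?_⟩
  · simp [faceAt]
  · rw [faceAt, fin4_add_one_add_three, cornerUnit_eq_off_sub]; abel

/-- Edge-adjacent cells differ by a unit vector. [folklore] -/
theorem crr_cellAdj_iff (c c' : Fin 2 → ℤ) : CellAdj c c' ↔ ∃ j : Fin 4, c' = c + cornerUnit j := by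
  constructor
  · rintro ⟨v, k, rfl, rfl⟩
    refine ⟨k + 3, ?_⟩
    have h2 : cornerUnit (k + 3) = cornerOff k - cornerOff (k + 3) := by fin_cases k <;> decide
    rw [faceAt, faceAt, h2]; abel
  · rintro ⟨j, rfl⟩
    exact crr_cellAdj_add_unit c j

/-- Two coordinate vectors are equal iff their coordinates are. [folklore] -/
theorem crr_vec2_eq_iff {a b c d : ℤ} : (![a, b] : Fin 2 → ℤ) = ![c, d] ↔ a = c ∧ b = d := by
  constructor
  · intro h
    exact ⟨by simpa using congrFun h 0, by simpa using congrFun h 1⟩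
  · rintro ⟨rfl, rfl⟩; rfl

/-- The unit translates of a cell, in coordinates. [folklore] -/
theorem crr_add_unit_eq (A B : ℤ) :
    (![A, B] : Fin 2 → ℤ) + cornerUnit 0 = ![A + 1, B] ∧ (![A, B] : Fin 2 → ℤ) + cornerUnit 1 = ![A, B + 1] ∧
    (![A, B] : Fin 2 → ℤ) + cornerUnit 2 = ![A - 1, B] ∧ (![A, B] : Fin 2 → ℤ) + cornerUnit 3 = ![A, B - 1] := by
  refine ⟨?_, ?_, ?_, ?_⟩ <;> ext i <;> fin_cases i <;> simp [cornerUnit] <;> ring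

/-- **The vertex square of a corner of a face is edge-adjacent to the face square** (both ways). [folklore] -/
theorem crr_cellAdj_of_corner {x f : ℤ × ℤ} (h : f.1 ≤ x.1 ∧ x.1 ≤ f.1 + 1 ∧ f.2 ≤ x.2 ∧ x.2 ≤ f.2 + 1) :
    CellAdj (![x.1 + x.2 - 1, x.2 - x.1] : Fin 2 → ℤ) ![f.1 + f.2, f.2 - f.1] ∧
      CellAdj (![f.1 + f.2, f.2 - f.1] : Fin 2 → ℤ) ![x.1 + x.2 - 1, x.2 - x.1] := by
  suffices H : CellAdj (![x.1 + x.2 - 1, x.2 - x.1] : Fin 2 → ℤ) ![f.1 + f.2, f.2 - f.1] from ⟨H, H.symm⟩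
  rw [crr_cellAdj_iff]
  obtain ⟨e0, e1, e2, e3⟩ := crr_add_unit_eq (x.1 + x.2 - 1) (x.2 - x.1)
  rcases (show (x.1 = f.1 ∨ x.1 = f.1 + 1) ∧ (x.2 = f.2 ∨ x.2 = f.2 + 1) by omega) with ⟨h1 | h1, h2 | h2⟩
  · exact ⟨0, by rw [e0, crr_vec2_eq_iff]; omega⟩
  · exact ⟨3, by rw [e3, crr_vec2_eq_iff]; omega⟩
  · exact ⟨1, by rw [e1, crr_vec2_eq_iff]; omega⟩
  · exact ⟨2, by rw [e2, crr_vec2_eq_iff]; omega⟩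

/-- The cells edge-adjacent to a vertex square are the face squares of the four faces at the
vertex. [folklore] -/
theorem crr_cellAdj_vertex_cases {x : ℤ × ℤ} {c : Fin 2 → ℤ}
    (h : CellAdj (![x.1 + x.2 - 1, x.2 - x.1] : Fin 2 → ℤ) c) :
    ∃ f : ℤ × ℤ, c = ![f.1 + f.2, f.2 - f.1] ∧ (f.1 ≤ x.1 ∧ x.1 ≤ f.1 + 1 ∧ f.2 ≤ x.2 ∧ x.2 ≤ f.2 + 1) := by
  obtain ⟨j, rfl⟩ := (crr_cellAdj_iff _ _).1 h
  obtain ⟨e0, e1, e2, e3⟩ := crr_add_unit_eq (x.1 + x.2 - 1) (x.2 - x.1)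
  fin_cases j
  · exact ⟨x, e0.trans (crr_vec2_eq_iff.2 ⟨by omega, by omega⟩), by omega⟩
  · exact ⟨(x.1 - 1, x.2), e1.trans (crr_vec2_eq_iff.2 ⟨by dsimp only; omega, by dsimp only; omega⟩),
      by dsimp only; omega⟩
  · exact ⟨(x.1 - 1, x.2 - 1), e2.trans (crr_vec2_eq_iff.2 ⟨by dsimp only; omega, by dsimp only; omega⟩),
      by dsimp only; omega⟩
  · exact ⟨(x.1, x.2 - 1), e3.trans (crr_vec2_eq_iff.2 ⟨by dsimp only; omega, by dsimp only; omega⟩),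
      by dsimp only; omega⟩

/-- The cells edge-adjacent to a face square are the vertex squares of its four corners. [folklore] -/
theorem crr_cellAdj_face_cases {f : ℤ × ℤ} {c : Fin 2 → ℤ}
    (h : CellAdj (![f.1 + f.2, f.2 - f.1] : Fin 2 → ℤ) c) :
    ∃ x : ℤ × ℤ, c = ![x.1 + x.2 - 1, x.2 - x.1] ∧ (f.1 ≤ x.1 ∧ x.1 ≤ f.1 + 1 ∧ f.2 ≤ x.2 ∧ x.2 ≤ f.2 + 1) := by
  obtain ⟨j, rfl⟩ := (crr_cellAdj_iff _ _).1 h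
  obtain ⟨e0, e1, e2, e3⟩ := crr_add_unit_eq (f.1 + f.2) (f.2 - f.1)
  fin_cases j
  · exact ⟨(f.1 + 1, f.2 + 1), e0.trans (crr_vec2_eq_iff.2 ⟨by dsimp only; omega, by dsimp only; omega⟩),
      by dsimp only; omega⟩
  · exact ⟨(f.1, f.2 + 1), e1.trans (crr_vec2_eq_iff.2 ⟨by dsimp only; omega, by dsimp only; omega⟩),
      by dsimp only; omega⟩
  · exact ⟨f, e2.trans (crr_vec2_eq_iff.2 ⟨by omega, by omega⟩), by omega⟩
  · exact ⟨(f.1 + 1, f.2), e3.trans (crr_vec2_eq_iff.2 ⟨by dsimp only; omega, by dsimp only; omega⟩),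
      by dsimp only; omega⟩

/-! ### Edge-connectedness of the cell region -/

/-- Chains of `U`-cells are reversible. [folklore] -/
theorem crr_uchain_symm (U : Finset (Fin 2 → ℤ)) {a b : Fin 2 → ℤ}
    (h : Relation.ReflTransGen (fun x y ↦ x ∈ U ∧ y ∈ U ∧ CellAdj x y) a b) :
    Relation.ReflTransGen (fun x y ↦ x ∈ U ∧ y ∈ U ∧ CellAdj x y) b a := by
  induction h with
  | refl => exact Relation.ReflTransGen.refl
  | tail _ hbc ih => exact Relation.ReflTransGen.head ⟨hbc.2.1, hbc.1, hbc.2.2.symm⟩ ih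

/-- The vertex square of a vertex of `V` and the vertex square of a king-neighbour cell `x ∈ U` are
joined in `U` through the face square of a common face. [folklore] -/
theorem crr_uchain_of_near (M : CollarLegModel) {x v : ℤ × ℤ} (hv : v ∈ M.V)
    (hx : (![x.1 + x.2 - 1, x.2 - x.1] : Fin 2 → ℤ) ∈ M.cellRegion.image (fun F : ℤ × ℤ ↦ (![F.1, F.2] : Fin 2 → ℤ)))
    (hnear : max |v.1 - x.1| |v.2 - x.2| ≤ 1) :
    Relation.ReflTransGen (fun a b ↦ a ∈ M.cellRegion.image (fun F : ℤ × ℤ ↦ (![F.1, F.2] : Fin 2 → ℤ)) ∧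
      b ∈ M.cellRegion.image (fun F : ℤ × ℤ ↦ (![F.1, F.2] : Fin 2 → ℤ)) ∧ CellAdj a b)
      ![x.1 + x.2 - 1, x.2 - x.1] ![v.1 + v.2 - 1, v.2 - v.1] := by
  simp only [max_le_iff, abs_le] at hnear
  set f : ℤ × ℤ := (min x.1 v.1, min x.2 v.2) with hf
  have hxf : f.1 ≤ x.1 ∧ x.1 ≤ f.1 + 1 ∧ f.2 ≤ x.2 ∧ x.2 ≤ f.2 + 1 := by simp only [hf]; omega
  have hvf : f.1 ≤ v.1 ∧ v.1 ≤ f.1 + 1 ∧ f.2 ≤ v.2 ∧ v.2 ≤ f.2 + 1 := by simp only [hf]; omega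
  have hfU : (![f.1 + f.2, f.2 - f.1] : Fin 2 → ℤ) ∈ M.cellRegion.image (fun F : ℤ × ℤ ↦ (![F.1, F.2] : Fin 2 → ℤ)) :=
    (crr_mem_U_face M f.1 f.2).2 ((crr_mem_faceCells_iff M f).2 ⟨v, hv, hvf⟩)
  have hvU : (![v.1 + v.2 - 1, v.2 - v.1] : Fin 2 → ℤ) ∈ M.cellRegion.image (fun F : ℤ × ℤ ↦ (![F.1, F.2] : Fin 2 → ℤ)) :=
    (crr_mem_U_vertex M v.1 v.2).2 (Finset.mem_union_left _ hv)
  exact Relation.ReflTransGen.head ⟨hx, hfU, (crr_cellAdj_of_corner hxf).1⟩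
    (Relation.ReflTransGen.single ⟨hfU, hvU, (crr_cellAdj_of_corner hvf).2⟩)

/-- Every cell of the region is joined in the region to the vertex square of a vertex of `V`. [folklore] -/
theorem crr_uchain_anchor (M : CollarLegModel) {o : Fin 2 → ℤ}
    (ho : o ∈ M.cellRegion.image (fun F : ℤ × ℤ ↦ (![F.1, F.2] : Fin 2 → ℤ))) :
    ∃ v ∈ M.V, Relation.ReflTransGen (fun a b ↦ a ∈ M.cellRegion.image (fun F : ℤ × ℤ ↦ (![F.1, F.2] : Fin 2 → ℤ)) ∧
      b ∈ M.cellRegion.image (fun F : ℤ × ℤ ↦ (![F.1, F.2] : Fin 2 → ℤ)) ∧ CellAdj a b)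
      o ![v.1 + v.2 - 1, v.2 - v.1] := by
  rcases crr_cell_cases o with ⟨x, rfl⟩ | ⟨f, rfl⟩
  · have hx := (crr_mem_U_vertex M x.1 x.2).1 ho
    rcases (crr_mem_vertexCells_iff M x).1 hx with h | h
    · exact ⟨x, h, Relation.ReflTransGen.refl⟩
    · obtain ⟨-, v, hv, hnear⟩ := crr_ghost_layer M h
      exact ⟨v, hv, crr_uchain_of_near M hv ho hnear⟩
  · have hf := (crr_mem_U_face M f.1 f.2).1 ho
    obtain ⟨u, hu, hbox⟩ := (crr_mem_faceCells_iff M f).1 hf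
    have huU : (![u.1 + u.2 - 1, u.2 - u.1] : Fin 2 → ℤ) ∈ M.cellRegion.image (fun F : ℤ × ℤ ↦ (![F.1, F.2] : Fin 2 → ℤ)) :=
      (crr_mem_U_vertex M u.1 u.2).2 (Finset.mem_union_left _ hu)
    exact ⟨u, hu, Relation.ReflTransGen.single ⟨ho, huU, (crr_cellAdj_of_corner hbox).2⟩⟩

/-- A lattice path in `V` gives a chain of cells of the region between the vertex squares. [folklore] -/
theorem crr_uchain_of_latticePath (M : CollarLegModel) {u w : ℤ × ℤ}
    (h : Relation.ReflTransGen (fun b c : ℤ × ℤ ↦ b ∈ M.V ∧ c ∈ M.V ∧ (b.1 - c.1) ^ 2 + (b.2 - c.2) ^ 2 = 1) u w) :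
    Relation.ReflTransGen (fun a b ↦ a ∈ M.cellRegion.image (fun F : ℤ × ℤ ↦ (![F.1, F.2] : Fin 2 → ℤ)) ∧
      b ∈ M.cellRegion.image (fun F : ℤ × ℤ ↦ (![F.1, F.2] : Fin 2 → ℤ)) ∧ CellAdj a b)
      ![u.1 + u.2 - 1, u.2 - u.1] ![w.1 + w.2 - 1, w.2 - w.1] := by
  induction h with
  | refl => exact Relation.ReflTransGen.refl
  | tail _ hbc ih =>
    obtain ⟨hb, hc, hstep⟩ := hbc
    refine ih.trans (crr_uchain_symm _ (crr_uchain_of_near M hb ((crr_mem_U_vertex M _ _).2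
      (Finset.mem_union_left _ hc)) ?_))
    have e1 : (_ : ℤ) ^ 2 ≤ 1 := le_of_le_of_eq (le_add_of_nonneg_right (sq_nonneg _)) hstep
    have e2 : (_ : ℤ) ^ 2 ≤ 1 := le_of_le_of_eq (le_add_of_nonneg_left (sq_nonneg _)) hstep
    exact max_le ((sq_le_one_iff_abs_le_one _).1 e1) ((sq_le_one_iff_abs_le_one _).1 e2)

/-- **The cell region of a model on a lattice-connected `V` is edge-connected.** [folklore] -/
theorem crr_edgeConn (M : CollarLegModel)
    (hconn : ∀ u ∈ M.V, ∀ w ∈ M.V, Relation.ReflTransGen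
      (fun b c : ℤ × ℤ ↦ b ∈ M.V ∧ c ∈ M.V ∧ (b.1 - c.1) ^ 2 + (b.2 - c.2) ^ 2 = 1) u w) :
    EdgeConn (M.cellRegion.image (fun F : ℤ × ℤ ↦ (![F.1, F.2] : Fin 2 → ℤ))) := by
  intro a ha b hb
  obtain ⟨u, hu, hau⟩ := crr_uchain_anchor M ha
  obtain ⟨w, hw, hbw⟩ := crr_uchain_anchor M hb
  exact hau.trans ((crr_uchain_of_latticePath M (hconn u hu w hw)).trans (crr_uchain_symm _ hbw))

/-- **Registered sub-goal `s15_cellRegion_edgeConn`** (one-line form of `crr_edgeConn`): the cell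
region of a collar leg model on a lattice-connected vertex set, transported to `Fin 2 → ℤ`, is
edge-connected. [folklore] -/
theorem s15_cellRegion_edgeConn : ∀ (M : Literature.Probability.LatticeModels.CollarLegModel), (∀ u ∈ M.V, ∀ w ∈ M.V, Relation.ReflTransGen (fun b c : ℤ × ℤ ↦ b ∈ M.V ∧ c ∈ M.V ∧ (b.1 - c.1) ^ 2 + (b.2 - c.2) ^ 2 = 1) u w) → Literature.Probability.Percolation.CellComplex.EdgeConn (M.cellRegion.image (fun F : ℤ × ℤ ↦ (![F.1, F.2] : Fin 2 → ℤ))) :=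
  fun M hconn ↦ crr_edgeConn M hconn

end Summit.CriticalPhenomena.CardyFormulaZ2.Cruxes.BoundaryDefectGaussianR.RainbowMonomialsInExcursionKernels
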